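import Summits.RiemannHypothesis.RiemannHypothesis.Theorems.IntegerScrewCensusFastTrig
import Literature.NumberTheory.LFunctions.ChainCheck
import Literature.Barriers.AtomisticToContinuum.DisorderedHarmonicChainCLT

/-!
# Route `IntegerScrew` — fast kernel arithmetic for manifest-certificate checks (3): the trig rows

For the manifest-certificate checks at `M = 48 … 112` the checker needs `e^{i t_k log m}` for every atom
`t_k = j_k/τ` and every `2 ≤ m ≤ n+1`.  This file computes them as offset fixed-point Gaussian integers
(`IntegerScrewCensusFastArith/Trig`):
* `primeVal` — for a BASE node `p` (log enclosure `[L, L+W]/2^48` from the tree's `FI.logTable`): ONE argument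
  reduction modulo `π/2` with `π` to 20 digits (`Real.pi_gt_d20/lt_d20`), the exact Taylor `cosSinFix` on
  `|ψ| ≤ 1`, and the rotation `i^q`; error `≤ 16·j·W/τ + 5` ulps per component (`primeVal_err`);
* `stepRow` — for a COMPOSITE `m = p·(m/p)` (`p ∈ {2,3,5,7,11,13}` by `smallFactor`) one complex product of
  the two earlier rows (`cmulRe/Im`), with the depth count `d(m) = 1 + d(m/p)` used by the error budget;
* `buildRows` / `rows` — all rows `m = 0 … n+1` (row `m` = the list over the atoms) and the range flags.
Pure arithmetic + `Real.cos/sin` facts; RH-free and ζ-free; nothing here bears on the truth of RH.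
-/

set_option linter.dupNamespace false
set_option autoImplicit false

namespace Summit.RiemannHypothesis.RiemannHypothesis.Theorems.IntegerScrew.Manifest.Fast

open Finset

/-! ### Argument reduction and the base values -/

/-- `⌊π · 10^20⌋` (`Real.pi_gt_d20`, `Real.pi_lt_d20`). -/
def PI20 : ℕ := 314159265358979323846

/-- `≈ 2^52 · π/2`, used only to CHOOSE the quarter-turn count `q` (any choice is sound). -/
def HP : ℕ := PI20 * SCL / (2 * 10 ^ 20)

/-- `⌊q · ⌊π·10^20⌋ · 2^52 / (2·10^20)⌋`: `2^52 · qπ/2` up to `< 2` ulps for `q ≤ 4096` (`qpi_bounds`). -/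
def qpi (q : ℕ) : ℕ := q * PI20 * SCL / (2 * 10 ^ 20)

/-- `Θ = ⌊16 · j · L / τ⌋ ≈ 2^52 · t · log p` from the lower end `L` (scale `2^48`) and `t = j/τ`. -/
def thetaN (L j τ : ℕ) : ℕ := j * L * 16 / τ

/-- The quarter-turn count `q ≈ Θ/(2^52 π/2)` (nearest; any value is sound). -/
def quot (Θ : ℕ) : ℕ := (2 * Θ + HP) / (2 * HP)

/-- The reduced angle, offset-encoded: `Ψ = Θ + OFF − qpi q` (`≈ 2^52 ψ + OFF`, `ψ = θ − qπ/2`). -/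
def psiN (L j τ : ℕ) : ℕ := thetaN L j τ + OFF - qpi (quot (thetaN L j τ))

/-- Rotation of an offset pair `(C, S) ≈ 2^52 e^{iψ}` by `i^r`, `r = q mod 4`. -/
def rot4 (r C S : ℕ) : ℕ × ℕ :=
  if r = 0 then (C, S) else if r = 1 then (oneg S, C) else if r = 2 then (oneg C, oneg S) else (S, oneg C)

/-- Sign and modulus of an offset-encoded angle: `(Ψ < OFF, |Ψ − OFF|)`. -/
def redA (Ψ : ℕ) : Bool × ℕ := (Nat.blt Ψ OFF, cond (Nat.blt Ψ OFF) (OFF - Ψ) (Ψ - OFF))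

/-- The value at a base node: input `L` = lower end of the `log p` enclosure (scale `2^48`), atom numerator `j`
and denominator `τ`; output `(ok, X, Y)` with `(X, Y) ≈ 2^52 e^{i (j/τ) log p}` offset-encoded and
`ok` = the range checks (`|ψ| ≤ 1`, `q ≤ 4096`) used by the error analysis. -/
def primeVal (tcs : List ℕ) (L j τ : ℕ) : Bool × ℕ × ℕ :=
  let nA := redA (psiN L j τ)
  let q := quot (thetaN L j τ)
  let cs := cosSinFix tcs nA.2 nA.1
  ((Nat.ble nA.2 SCL && Nat.ble q 4096), rot4 (q % 4) cs.1 cs.2)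

/-- The row of a base node: `primeVal` over the atom list (flag = all range checks passed). -/
def primeRow (tcs : List ℕ) (L τ : ℕ) : List ℕ → Bool × List (ℕ × ℕ)
  | [] => (true, [])
  | j :: js =>
    let v := primeVal tcs L j τ
    let r := primeRow tcs L τ js
    (v.1 && r.1, v.2 :: r.2)

/-- The row of a composite `m = p · q'`: termwise complex product of the rows of `p` and `q'`. -/
def stepRow : List (ℕ × ℕ) → List (ℕ × ℕ) → List (ℕ × ℕ)
  | a :: as, b :: bs => (cmulRe a.1 a.2 b.1 b.2, cmulIm a.1 a.2 b.1 b.2) :: stepRow as bs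
  | _, _ => []

/-- A small factor by trial division with `2, 3, 5, 7, 11, 13` (else `m` itself): for `m < 289` this finds a
prime factor of every composite `m`; correctness of the rows needs only `smallFactor m ∣ m`. -/
def smallFactor (m : ℕ) : ℕ :=
  if m % 2 = 0 then 2 else if m % 3 = 0 then 3 else if m % 5 = 0 then 5 else if m % 7 = 0 then 7
  else if m % 11 = 0 then 11 else if m % 13 = 0 then 13 else m

/-- The lower end and the width of the `m`-th log enclosure of a table (scale `2^48`; `toNat` junk for negative
entries, which the validity checks exclude). -/
def logLoW (logs : List Literature.Analysis.ValidatedNumerics.Numerics.FI) (m : ℕ) : ℕ × ℕ :=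
  let I := logs.getD m (Literature.Analysis.ValidatedNumerics.Numerics.FI.ofInt 0)
  (I.lo.toNat, (I.hi - I.lo).toNat)

/-- Build the rows `m = 0, 1, …` with their depths: `acc` holds `(depth, row)` for the `m` built so far
(position `m`); `m = 0, 1` are placeholders; a base row by `primeRow` (depth `1`), a composite row
`m = p · (m/p)`, `p = smallFactor m < m`, by `stepRow` (depth `1 + d(m/p)`).  The flag conjoins the range
checks and `depth ≤ 8`. -/
def buildRows (tcs : List ℕ) (logs : List Literature.Analysis.ValidatedNumerics.Numerics.FI) (τ : ℕ)
    (js : List ℕ) : ℕ → List (ℕ × List (ℕ × ℕ)) → Bool → List (ℕ × List (ℕ × ℕ)) × Bool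
  | 0, acc, ok => (acc, ok)
  | fuel + 1, acc, ok =>
    let m := acc.length
    if m < 2 then buildRows tcs logs τ js fuel (acc ++ [(0, [])]) ok
    else
      let p := smallFactor m
      if p = m then
        let r := primeRow tcs (logLoW logs m).1 τ js
        buildRows tcs logs τ js fuel (acc ++ [(1, r.2)]) (ok && r.1)
      else
        let a := acc.getD p (0, [])
        let b := acc.getD (m / p) (0, [])
        buildRows tcs logs τ js fuel (acc ++ [(b.1 + 1, stepRow a.2 b.2)]) (ok && Nat.ble (b.1 + 1) 8)

/-- All rows `0 … n+1` (with depths) and the flag. -/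
def rows (tcs : List ℕ) (logs : List Literature.Analysis.ValidatedNumerics.Numerics.FI) (τ : ℕ)
    (js : List ℕ) (n : ℕ) : List (ℕ × List (ℕ × ℕ)) × Bool :=
  buildRows tcs logs τ js (n + 2) [] true

/-- The largest width of the log enclosures of the nodes `2 ≤ m ≤ N` (scale `2^48`). -/
def maxLogWidth (logs : List Literature.Analysis.ValidatedNumerics.Numerics.FI) : ℕ → ℕ
  | 0 => 0
  | N + 1 => max (maxLogWidth logs N) (logLoW logs (N + 1)).2

/-! ### Error analysis of the base values -/

/-- `π · 10^20 ∈ (PI20, PI20 + 1)`. -/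
theorem pi20_bounds : (PI20 : ℝ) < Real.pi * 10 ^ 20 ∧ Real.pi * 10 ^ 20 < (PI20 : ℝ) + 1 := by
  constructor
  · have := Real.pi_gt_d20; norm_num [PI20] at this ⊢; linarith
  · have := Real.pi_lt_d20; norm_num [PI20] at this ⊢; linarith

/-- **`qpi q` is `2^52·qπ/2` up to `[0, 2)` ulps** for `q ≤ 4096`:
`qpi q ≤ 2^52·qπ/2 < qpi q + 2`. -/
theorem qpi_bounds {q : ℕ} (hq : q ≤ 4096) :
    (qpi q : ℝ) ≤ SCL * (q * (Real.pi / 2)) ∧ SCL * (q * (Real.pi / 2)) < (qpi q : ℝ) + 2 := by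
  obtain ⟨hp1, hp2⟩ := pi20_bounds
  have hden : (0 : ℕ) < 2 * 10 ^ 20 := by norm_num
  obtain ⟨h1, h2⟩ := Literature.NumberTheory.LFunctions.ChainCheck.natDiv_real_bounds (q * PI20 * SCL) hden
  unfold qpi
  have hq' : (q : ℝ) ≤ 4096 := by exact_mod_cast hq
  have hq0 : (0 : ℝ) ≤ q := Nat.cast_nonneg q
  have hS : (SCL : ℝ) = 2 ^ 52 := by norm_num [SCL]
  push_cast at h1 h2 ⊢
  rw [hS] at h1 h2 ⊢
  have hlo : (q : ℝ) * PI20 * 2 ^ 52 / (2 * 10 ^ 20) ≤ 2 ^ 52 * (q * (Real.pi / 2)) := by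
    rw [div_le_iff₀ (by norm_num)]
    nlinarith
  have hhi : (2 : ℝ) ^ 52 * (q * (Real.pi / 2)) ≤
      (q : ℝ) * PI20 * 2 ^ 52 / (2 * 10 ^ 20) + (q : ℝ) * 2 ^ 52 / (2 * 10 ^ 20) := by
    rw [← add_div, le_div_iff₀ (by norm_num)]
    nlinarith
  have hsmall : (q : ℝ) * 2 ^ 52 / (2 * 10 ^ 20) < 1 := by
    rw [div_lt_one (by norm_num)]
    nlinarith
  norm_num at h1 h2 hlo hhi hsmall ⊢
  constructor
  · linarith
  · linarith

/-- The reduced `cos/sin` pair: with `D = Ψ − OFF` (an integer, `|D| ≤ 2^52`), the two components of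
`cosSinFix tcList |D| (D < 0)` are within `2` ulps of `2^52 cos(D/2^52)`, `2^52 sin(D/2^52)`. -/
theorem cosSin_redA_err {Ψ : ℕ} (hA : (redA Ψ).2 ≤ SCL) :
    |(oval (cosSinFix tcList (redA Ψ).2 (redA Ψ).1).1 : ℝ) - SCL * Real.cos ((((Ψ : ℤ) - OFF : ℤ) : ℝ) / SCL)| ≤ 2 ∧
    |(oval (cosSinFix tcList (redA Ψ).2 (redA Ψ).1).2 : ℝ) - SCL * Real.sin ((((Ψ : ℤ) - OFF : ℤ) : ℝ) / SCL)| ≤ 2 := by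
  rw [cosSinFix_fst, cosSinFix_snd]
  unfold redA at hA ⊢
  rcases Bool.eq_false_or_eq_true (Nat.blt Ψ OFF) with hlt | hlt
  · -- `Ψ < OFF`: negative angle
    rw [hlt, cond_true] at hA ⊢
    have hlt' : Ψ < OFF := by simpa [Nat.blt_eq] using hlt
    have hD : ((((Ψ : ℤ) - OFF : ℤ)) : ℝ) = -(((OFF - Ψ : ℕ) : ℝ)) := by push_cast [Nat.cast_sub hlt'.le]; ring
    rw [hD, neg_div, Real.cos_neg]
    exact ⟨cosFix_err hA, sinFix_err_true hA⟩
  · -- `OFF ≤ Ψ`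
    rw [hlt, cond_false] at hA ⊢
    have hge : OFF ≤ Ψ := Nat.le_of_not_lt fun h => by
      have h2 : Nat.blt Ψ OFF = true := by rw [Nat.blt_eq]; exact h
      rw [hlt] at h2
      exact Bool.false_ne_true h2
    have hD : ((((Ψ : ℤ) - OFF : ℤ)) : ℝ) = ((Ψ - OFF : ℕ) : ℝ) := by push_cast [Nat.cast_sub hge]; ring
    rw [hD]
    exact ⟨cosFix_err hA, sinFix_err_false hA⟩

/-- Semantics of `rot4`: rotating a pair that approximates `2^52 e^{iψ}` within `E` by `i^r` gives a pair that
approximates `2^52 e^{i(ψ + rπ/2)}` within `E` (`r < 4`; the negations are exact for `|values| ≤ 2^199`). -/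
theorem rot4_err {r C S : ℕ} (hr : r < 4) {ψ E : ℝ} (hC : |(oval C : ℝ) - SCL * Real.cos ψ| ≤ E)
    (hS : |(oval S : ℝ) - SCL * Real.sin ψ| ≤ E) (hCb : |oval C| ≤ 2 ^ 199) (hSb : |oval S| ≤ 2 ^ 199) :
    |(oval (rot4 r C S).1 : ℝ) - SCL * Real.cos (ψ + r * (Real.pi / 2))| ≤ E ∧
    |(oval (rot4 r C S).2 : ℝ) - SCL * Real.sin (ψ + r * (Real.pi / 2))| ≤ E := by
  unfold rot4
  rcases (by omega : r = 0 ∨ r = 1 ∨ r = 2 ∨ r = 3) with h | h | h | h <;> subst h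
  · simpa using And.intro hC hS
  · simp only [show (1 : ℕ) ≠ 0 from by omega, if_false, if_true, Nat.cast_one, one_mul,
      Real.cos_add_pi_div_two, Real.sin_add_pi_div_two, oval_oneg hSb, Int.cast_neg]
    refine ⟨?_, hC⟩
    rw [show -(oval S : ℝ) - SCL * -Real.sin ψ = -((oval S : ℝ) - SCL * Real.sin ψ) by ring, abs_neg]
    exact hS
  · simp only [show (2 : ℕ) ≠ 0 from by omega, show (2 : ℕ) ≠ 1 from by omega, if_false, if_true,
      oval_oneg hSb, oval_oneg hCb, Int.cast_neg]
    rw [show ψ + ((2 : ℕ) : ℝ) * (Real.pi / 2) = ψ + Real.pi by push_cast; ring, Real.cos_add_pi, Real.sin_add_pi]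
    constructor
    · rw [show -(oval C : ℝ) - SCL * -Real.cos ψ = -((oval C : ℝ) - SCL * Real.cos ψ) by ring, abs_neg]
      exact hC
    · rw [show -(oval S : ℝ) - SCL * -Real.sin ψ = -((oval S : ℝ) - SCL * Real.sin ψ) by ring, abs_neg]
      exact hS
  · simp only [show (3 : ℕ) ≠ 0 from by omega, show (3 : ℕ) ≠ 1 from by omega,
      show (3 : ℕ) ≠ 2 from by omega, if_false, oval_oneg hCb, Int.cast_neg]
    rw [show ψ + ((3 : ℕ) : ℝ) * (Real.pi / 2) = (ψ + Real.pi) + Real.pi / 2 by push_cast; ring,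
      Real.cos_add_pi_div_two, Real.sin_add_pi_div_two, Real.sin_add_pi, Real.cos_add_pi, neg_neg]
    refine ⟨hS, ?_⟩
    rw [show -(oval C : ℝ) - SCL * -Real.cos ψ = -((oval C : ℝ) - SCL * Real.cos ψ) by ring, abs_neg]
    exact hC

/-- **Error of the base values.**  If `[L, L + W]/2^48 ∋ x` (the node's logarithm), `t = j/τ`, and the range
flag of `primeVal` is set, then both components of `primeVal` are within `16·j·W/τ + 5` ulps of
`2^52 cos(t x)`, `2^52 sin(t x)` (the hypothesis `16jW/τ + 5 ≤ 2^60` only rules out absurd inputs). -/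
theorem primeVal_err {L W j τ : ℕ} {x : ℝ} (hτ : 0 < τ) (hlo : (L : ℝ) ≤ 2 ^ 48 * x)
    (hhi : (2 : ℝ) ^ 48 * x ≤ (L : ℝ) + W) (hE : (16 * j * W : ℝ) / τ + 5 ≤ 2 ^ 60)
    (hok : (primeVal tcList L j τ).1 = true) :
    |(oval (primeVal tcList L j τ).2.1 : ℝ) - SCL * Real.cos ((j : ℝ) / τ * x)| ≤ 16 * j * W / τ + 5 ∧
    |(oval (primeVal tcList L j τ).2.2 : ℝ) - SCL * Real.sin ((j : ℝ) / τ * x)| ≤ 16 * j * W / τ + 5 := by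
  -- names and the flag
  simp only [primeVal] at hok ⊢
  set Θ := thetaN L j τ with hΘ
  set q := quot Θ with hq
  set Ψ := psiN L j τ with hΨ
  rw [Bool.and_eq_true, Nat.ble_eq, Nat.ble_eq] at hok
  obtain ⟨hA, hq4⟩ := hok
  have hS : (0 : ℝ) < SCL := by norm_num [SCL]
  have hSv : (SCL : ℝ) = 2 ^ 52 := by norm_num [SCL]
  have hτr : (0 : ℝ) < τ := by exact_mod_cast hτ
  have hj0 : (0 : ℝ) ≤ j := Nat.cast_nonneg j
  have hW0 : (0 : ℝ) ≤ W := Nat.cast_nonneg W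
  -- (1) Θ = ⌊16 j L/τ⌋
  obtain ⟨hΘ1, hΘ2⟩ := Literature.NumberTheory.LFunctions.ChainCheck.natDiv_real_bounds (j * L * 16) hτ
  have hΘeq : (j * L * 16 / τ : ℕ) = Θ := by rw [hΘ]; rfl
  rw [hΘeq] at hΘ1 hΘ2
  push_cast at hΘ1 hΘ2
  -- (2) qpi q vs 2^52 qπ/2
  obtain ⟨hP1, hP2⟩ := qpi_bounds hq4
  -- (3) the offset subtraction in Ψ is exact
  have hq4r : (q : ℝ) ≤ 4096 := by exact_mod_cast hq4
  have hqpiOFF : qpi q ≤ Θ + OFF := by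
    have hqp : (q : ℝ) * (Real.pi / 2) ≤ 4096 * 2 := by
      nlinarith [Real.pi_lt_four, Real.pi_pos, hq4r, (Nat.cast_nonneg q : (0 : ℝ) ≤ q)]
    have h0 : (SCL : ℝ) * ((q : ℝ) * (Real.pi / 2)) ≤ (2 : ℝ) ^ 52 * (4096 * 2) := by
      rw [hSv]; exact mul_le_mul_of_nonneg_left hqp (by positivity)
    have h1 : (qpi q : ℝ) ≤ (OFF : ℝ) := by
      have : (2 : ℝ) ^ 52 * (4096 * 2) ≤ OFF := by norm_num [OFF]
      linarith
    have h3 : qpi q ≤ OFF := by exact_mod_cast h1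
    omega
  have hD : (((Ψ : ℤ) - OFF : ℤ) : ℝ) = (Θ : ℝ) - (qpi q : ℝ) := by
    have : (Ψ : ℤ) = (Θ : ℤ) + OFF - qpi q := by
      rw [hΨ]; unfold psiN; rw [← hΘ, ← hq]; push_cast [Nat.cast_sub hqpiOFF]; ring
    push_cast [this]; ring
  -- (4) the reduced angle
  set ψ : ℝ := (j : ℝ) / τ * x - q * (Real.pi / 2) with hψ
  have hkey : |(SCL : ℝ) * ψ - ((Θ : ℝ) - (qpi q : ℝ))| ≤ 16 * j * W / τ + 2 := by
    have e1 : (SCL : ℝ) * ((j : ℝ) / τ * x) = 16 * j * (2 ^ 48 * x) / τ := by rw [hSv]; ring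
    have hj16 : (0 : ℝ) ≤ 16 * j := by positivity
    have hlo' : 16 * (j : ℝ) * L / τ ≤ (SCL : ℝ) * ((j : ℝ) / τ * x) := by
      rw [e1]
      refine div_le_div_of_nonneg_right ?_ hτr.le
      have := mul_le_mul_of_nonneg_left hlo hj16
      linarith
    have hhi' : (SCL : ℝ) * ((j : ℝ) / τ * x) ≤ 16 * (j : ℝ) * L / τ + 16 * j * W / τ := by
      rw [e1, ← add_div]
      refine div_le_div_of_nonneg_right ?_ hτr.le
      have := mul_le_mul_of_nonneg_left hhi hj16
      linarith
    have e3 : ((j : ℝ) * L * 16) / τ = 16 * j * L / τ := by ring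
    rw [e3] at hΘ1 hΘ2
    have hψ' : (SCL : ℝ) * ψ = SCL * ((j : ℝ) / τ * x) - SCL * (q * (Real.pi / 2)) := by rw [hψ]; ring
    rw [abs_le, hψ']
    constructor <;> linarith
  -- (5)+(6) the reduced cos/sin pair
  obtain ⟨hC0, hS0⟩ := cosSin_redA_err (Ψ := Ψ) hA
  rw [hD] at hC0 hS0
  set C := (cosSinFix tcList (redA Ψ).2 (redA Ψ).1).1 with hCdef
  set Sn := (cosSinFix tcList (redA Ψ).2 (redA Ψ).1).2 with hSdef
  have hdist : (SCL : ℝ) * |((Θ : ℝ) - qpi q) / SCL - ψ| ≤ 16 * j * W / τ + 2 := by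
    have h3 : (SCL : ℝ) * |((Θ : ℝ) - qpi q) / SCL - ψ| = |(SCL : ℝ) * ψ - ((Θ : ℝ) - qpi q)| := by
      rw [← abs_of_pos hS, ← abs_mul, abs_of_pos hS, abs_sub_comm]
      congr 1
      field_simp
    rw [h3]; exact hkey
  have hcos : |(oval C : ℝ) - SCL * Real.cos ψ| ≤ 16 * j * W / τ + 4 := by
    have h2 := Literature.Barriers.AtomisticToContinuum.HeatConduction.abs_cos_sub_cos_le' (((Θ : ℝ) - qpi q) / SCL) ψ
    have h1 : |(SCL : ℝ) * Real.cos (((Θ : ℝ) - qpi q) / SCL) - SCL * Real.cos ψ| ≤ 16 * j * W / τ + 2 := by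
      rw [← mul_sub, abs_mul, abs_of_pos hS]
      exact (mul_le_mul_of_nonneg_left h2 hS.le).trans hdist
    have := abs_sub_le (oval C : ℝ) (SCL * Real.cos (((Θ : ℝ) - qpi q) / SCL)) (SCL * Real.cos ψ)
    linarith
  have hsin : |(oval Sn : ℝ) - SCL * Real.sin ψ| ≤ 16 * j * W / τ + 4 := by
    have h2 := Literature.Barriers.AtomisticToContinuum.HeatConduction.abs_sin_sub_sin_le' (((Θ : ℝ) - qpi q) / SCL) ψ
    have h1 : |(SCL : ℝ) * Real.sin (((Θ : ℝ) - qpi q) / SCL) - SCL * Real.sin ψ| ≤ 16 * j * W / τ + 2 := by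
      rw [← mul_sub, abs_mul, abs_of_pos hS]
      exact (mul_le_mul_of_nonneg_left h2 hS.le).trans hdist
    have := abs_sub_le (oval Sn : ℝ) (SCL * Real.sin (((Θ : ℝ) - qpi q) / SCL)) (SCL * Real.sin ψ)
    linarith
  -- (7) size bounds for the negations
  have hcosb : |(SCL : ℝ) * Real.cos ψ| ≤ 2 ^ 52 := by
    rw [abs_mul, abs_of_pos hS, hSv]
    exact mul_le_of_le_one_right (by positivity) (Real.abs_cos_le_one ψ)
  have hsinb : |(SCL : ℝ) * Real.sin ψ| ≤ 2 ^ 52 := by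
    rw [abs_mul, abs_of_pos hS, hSv]
    exact mul_le_of_le_one_right (by positivity) (Real.abs_sin_le_one ψ)
  have hCb : |oval C| ≤ 2 ^ 199 := by
    have h1 : |(oval C : ℝ)| ≤ 2 ^ 199 := by
      have := abs_sub_abs_le_abs_sub (oval C : ℝ) (SCL * Real.cos ψ)
      linarith
    exact_mod_cast h1
  have hSb : |oval Sn| ≤ 2 ^ 199 := by
    have h1 : |(oval Sn : ℝ)| ≤ 2 ^ 199 := by
      have := abs_sub_abs_le_abs_sub (oval Sn : ℝ) (SCL * Real.sin ψ)
      linarith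
    exact_mod_cast h1
  -- (8)+(9) the rotation and the angle bookkeeping
  obtain ⟨hR1, hR2⟩ := rot4_err (r := q % 4) (Nat.mod_lt q (by norm_num)) hcos hsin hCb hSb
  have hang : (j : ℝ) / τ * x = ψ + ((q % 4 : ℕ) : ℝ) * (Real.pi / 2) + ((q / 4 : ℕ) : ℝ) * (2 * Real.pi) := by
    have hdm : ((q : ℕ) : ℝ) = 4 * ((q / 4 : ℕ) : ℝ) + ((q % 4 : ℕ) : ℝ) := by
      exact_mod_cast (Nat.div_add_mod q 4).symm
    rw [hψ, hdm]; ring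
  rw [hang, Real.cos_add_nat_mul_two_pi, Real.sin_add_nat_mul_two_pi]
  constructor
  · exact hR1.trans (by linarith)
  · exact hR2.trans (by linarith)

end Summit.RiemannHypothesis.RiemannHypothesis.Theorems.IntegerScrew.Manifest.Fast
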